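import Summits.KontsevichZagierPeriods.KontsevichZagierPeriods.Theses.FurushoPentagon
import Literature.NumberTheory.Transcendental.KZCubicalCalculus
import Literature.NumberTheory.Transcendental.KZLogCalculusProofs
import Literature.NumberTheory.Transcendental.SemialgebraicMapsProofs
import Literature.NumberTheory.Transcendental.SemialgebraicDerivativeProofs
import Literature.ModelTheory.ExponentialFields.SemialgebraicPartialDeriv
import Literature.ModelTheory.ExponentialFields.SemialgebraicInterior

/-!
# `SectorToKernel`, line `effective-cube-surjection`: the Stokes span calibration (stub S5)

Stub `stub_stokesSpanCalibration` of the crux `FurushoPentagon.SectorToKernel`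
(stmt-KontsevichZagierPeriods-10813). A representation `t` on the closed unit cube `[0,1]ᴹ` whose
integrand agrees on the cube with a finite sum of real Stokes elements
`∂_{i j} Hⱼ − Hⱼ|_{x_{i j}=1} + Hⱼ|_{x_{i j}=0}` (`Hⱼ` analytic near the cube and `ℚ`-semialgebraic
on it) is a relation of the Kontsevich–Zagier calculus. Every step is a move already in the tree:
along the LAST coordinate `[[0,1]ⁿ⁺¹, ∂ₜF] ∼ [[0,1]ⁿ, F(·,1) − F(·,0)]` and the slab
`[[0,1]ⁿ⁺¹, g ∘ init] ∼ [[0,1]ⁿ, g]` (primitive `(x, t) ↦ t · g x`) are Newton–Leibniz moves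
(`KZ.cubicalStokesGens_subset_relations`); a coordinate `c` is moved to the last slot by the
transposition `Φ z = z ∘ (c last)`, a change of variables of the cube onto itself with `|det Φ| = 1`
(`KZ.cubicalCovGens_subset_relations`); sums are split by integrand additivity
(`KZ.of_sub_of_sub_sum_mem_relations`). The one delicate point, `ℚ`-semialgebraicity of `∂_last F`
on the CLOSED cube, is Basu–Pollack–Roy's Prop. 3.22 on the cube with open last coordinate
(`IsSemialgebraicFunOn.hasDerivAt_last_isSemialgebraic_holds`) followed by a closure of the graph
(`isSemialgebraic_closure`, Bochnak–Coste–Roy Prop. 2.2.2; `∂_last F` is continuous on the cube).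

References: M. Kontsevich, D. Zagier, *Periods* (2001), §1.2 rules (1)–(3); J. Ayoub, *Periods and
the conjectures of Grothendieck and Kontsevich–Zagier* (2014), Def. 10; J. Bochnak, M. Coste,
M.-F. Roy, *Real Algebraic Geometry* (1998), Prop. 2.2.2; S. Basu, R. Pollack, M.-F. Roy,
*Algorithms in Real Algebraic Geometry* (2006), Prop. 3.22.
-/

noncomputable section

namespace Summit.KontsevichZagierPeriods.FurushoPentagon.SectorToKernel

open Set MeasureTheory
open Literature.NumberTheory.Transcendental
open Literature.NumberTheory.Transcendental.KZ hiding cubicalSpan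
open Summit.KontsevichZagierPeriods.KontsevichZagierPeriods.Theses.FurushoPentagon

/-- **Semialgebraicity by closure.** If `f` is `ℚ`-semialgebraic on `s` and continuous on a compact
`t` with `s ⊆ t ⊆ closure s`, then `f` is `ℚ`-semialgebraic on `t`: the graph over `t` is the
closure of the graph over `s`. [Bochnak–Coste–Roy 1998, Prop. 2.2.2] -/
theorem stokesCal_isSemialgebraicFunOn_of_subset_closure {m : ℕ} {s t : Set (Fin m → ℝ)}
    {f : (Fin m → ℝ) → ℝ} (hf : IsSemialgebraicFunOn ℚ s f) (hst : s ⊆ t) (hts : t ⊆ closure s)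
    (ht : IsCompact t) (hfc : ContinuousOn f t) : IsSemialgebraicFunOn ℚ t f := by
  -- the graph map `φ z = (z, f z)`
  obtain ⟨φ, hφ⟩ : ∃ φ : (Fin m → ℝ) → (Fin (m + 1) → ℝ),
      φ = fun z => (Fin.snoc z (f z) : Fin (m + 1) → ℝ) :=
    ⟨fun z => (Fin.snoc z (f z) : Fin (m + 1) → ℝ), rfl⟩
  have hgraph : ∀ u : Set (Fin m → ℝ),
      {w : Fin (m + 1) → ℝ | ∃ x ∈ u, w = Fin.snoc x (f x)} = φ '' u := fun u =>
    Set.ext fun w =>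
      ⟨fun ⟨x, hx, h⟩ => ⟨x, hx, by rw [hφ, h]⟩, fun ⟨x, hx, h⟩ => ⟨x, hx, by rw [← h, hφ]⟩⟩
  have hφc : ContinuousOn φ t := by
    rw [hφ]
    refine continuousOn_pi.2 fun i => ?_
    induction i using Fin.lastCases with
    | last => simpa using hfc
    | cast j => simpa using (continuous_apply j).continuousOn
  have hcl : closure s = t := Subset.antisymm (ht.isClosed.closure_subset_iff.mpr hst) hts
  have hφc' : ContinuousOn φ (closure s) := by rw [hcl]; exact hφc
  have heq : φ '' t = closure (φ '' s) := by
    refine Subset.antisymm ?_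
      ((ht.image_of_continuousOn hφc).isClosed.closure_subset_iff.mpr (image_mono hst))
    have h := hφc'.image_closure
    rwa [hcl] at h
  unfold IsSemialgebraicFunOn at hf ⊢
  rw [hgraph] at hf
  rw [hgraph, heq]
  exact Literature.ModelTheory.ExponentialFields.isSemialgebraic_closure hf

/-- The closed cube `[0,1]ⁿ⁺¹` lies in the closure of the cube with open last coordinate
`{z | init z ∈ [0,1]ⁿ, 0 < z last < 1}` (a product of intervals and its closure). [folklore] -/
theorem stokesCal_cube_subset_closure_band (n : ℕ) :
    KZ.cube (n + 1) ⊆ closure {z : Fin (n + 1) → ℝ | Fin.init z ∈ KZ.cube n ∧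
      0 < z (Fin.last n) ∧ z (Fin.last n) < 1} := by
  have hB : {z : Fin (n + 1) → ℝ | Fin.init z ∈ KZ.cube n ∧ 0 < z (Fin.last n) ∧ z (Fin.last n) < 1}
      = Set.pi univ
        (Fin.snoc (fun _ : Fin n => Icc (0 : ℝ) 1) (Ioo (0 : ℝ) 1) : Fin (n + 1) → Set ℝ) := by
    ext z
    simp only [mem_setOf_eq, mem_univ_pi, KZ.mem_cube, Fin.forall_fin_succ', Fin.snoc_castSucc,
      Fin.snoc_last, mem_Icc, mem_Ioo, Fin.init]
  intro z hz
  rw [hB, closure_pi_set, mem_univ_pi]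
  rw [KZ.mem_cube] at hz
  intro i
  induction i using Fin.lastCases with
  | last => simpa only [Fin.snoc_last, closure_Ioo (zero_ne_one' ℝ), mem_Icc] using hz _
  | cast j => simpa only [Fin.snoc_castSucc, closure_Icc, mem_Icc] using hz _

/-- Chain rule along the last coordinate: `∂ₛ F (x, s) = DF (x, s) · e_last`. [folklore] -/
theorem stokesCal_hasDerivAt_snoc {n : ℕ} {F : (Fin (n + 1) → ℝ) → ℝ} {x : Fin n → ℝ} {t : ℝ}
    (hF : DifferentiableAt ℝ F (Fin.snoc x t)) :
    HasDerivAt (fun s : ℝ => F (Fin.snoc x s))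
      (fderiv ℝ F (Fin.snoc x t) (Pi.single (Fin.last n) 1)) t := by
  have h2 : HasFDerivAt F (fderiv ℝ F (Fin.snoc x t))
      (Function.update (Fin.snoc x 0 : Fin (n + 1) → ℝ) (Fin.last n) t) := by
    rw [Fin.update_snoc_last]; exact hF.hasFDerivAt
  have hfun : (fun s : ℝ => F (Fin.snoc x s)) =
      F ∘ Function.update (Fin.snoc x 0 : Fin (n + 1) → ℝ) (Fin.last n) :=
    funext fun s => by simp only [Function.comp_apply, Fin.update_snoc_last]
  rw [hfun]
  exact h2.comp_hasDerivAt t (hasDerivAt_update _ _ _)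

/-- The partial derivative `w ↦ DF(w) · v` of a function analytic near a set is analytic near it.
[folklore] -/
theorem stokesCal_analyticOnNhd_fderiv_apply {n : ℕ} {F : (Fin n → ℝ) → ℝ} {s : Set (Fin n → ℝ)}
    (hF : AnalyticOnNhd ℝ F s) (v : Fin n → ℝ) :
    AnalyticOnNhd ℝ (fun w => fderiv ℝ F w v) s := by
  have hfun : (fun w => fderiv ℝ F w v) = (ContinuousLinearMap.apply ℝ ℝ v) ∘ fderiv ℝ F :=
    funext fun w => by simp
  rw [hfun]
  exact (ContinuousLinearMap.apply ℝ ℝ v).comp_analyticOnNhd hF.fderiv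

/-- Appending a constant last coordinate, `x ↦ (x, a)`, is analytic. [folklore] -/
theorem stokesCal_analyticOnNhd_snoc (n : ℕ) (a : ℝ) :
    AnalyticOnNhd ℝ (fun x : Fin n → ℝ => (Fin.snoc x a : Fin (n + 1) → ℝ)) univ := by
  have h : ∀ i : Fin (n + 1),
      AnalyticOnNhd ℝ (fun x : Fin n → ℝ => (Fin.snoc x a : Fin (n + 1) → ℝ) i) univ := by
    intro i
    induction i using Fin.lastCases with
    | last => simpa only [Fin.snoc_last] using analyticOnNhd_const
    | cast j =>
      simp only [Fin.snoc_castSucc]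
      exact (ContinuousLinearMap.proj (R := ℝ) (φ := fun _ : Fin n => ℝ) j).analyticOnNhd _
  exact AnalyticOnNhd.pi h

/-- Appending a rational constant last coordinate, `x ↦ (x, q)`, is a polynomial map, hence
`ℚ`-semialgebraic on the cube. [Bochnak–Coste–Roy 1998, §2.2] -/
theorem stokesCal_isSemialgebraicMapOn_snoc (n : ℕ) (q : ℚ) :
    IsSemialgebraicMapOn ℚ (KZ.cube n)
      (fun x : Fin n → ℝ => (Fin.snoc x (q : ℝ) : Fin (n + 1) → ℝ)) := by
  refine (isSemialgebraicMapOn_aeval (R := ℝ) KZ.isSemialgebraic_cube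
    (Fin.snoc (fun j => MvPolynomial.X j) (MvPolynomial.C q) :
      Fin (n + 1) → MvPolynomial (Fin n) ℚ)).congr fun x _ => ?_
  funext i
  induction i using Fin.lastCases with
  | last => simp
  | cast j => simp

/-- **The partial derivative along the last coordinate of a function analytic near the closed cube
and `ℚ`-semialgebraic on it is `ℚ`-semialgebraic on the closed cube**: on the cube with open last
coordinate this is Basu–Pollack–Roy's Prop. 3.22
(`IsSemialgebraicFunOn.hasDerivAt_last_isSemialgebraic_holds`), and the graph over the closed cube
is the closure of that graph.
[Basu–Pollack–Roy 2006, Prop. 3.22; Bochnak–Coste–Roy 1998, Prop. 2.2.2] -/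
theorem stokesCal_isSemialgebraicFunOn_fderiv_last {n : ℕ} {F : (Fin (n + 1) → ℝ) → ℝ}
    (hFa : AnalyticOnNhd ℝ F (KZ.cube (n + 1)))
    (hFs : IsSemialgebraicFunOn ℚ (KZ.cube (n + 1)) F) :
    IsSemialgebraicFunOn ℚ (KZ.cube (n + 1))
      (fun w => fderiv ℝ F w (Pi.single (Fin.last n) 1)) := by
  have h0 : IsSemialgebraicFunOn ℚ (KZ.cube n) (fun _ : Fin n → ℝ => (0 : ℝ)) := by
    simpa using isSemialgebraicFunOn_ratCast KZ.isSemialgebraic_cube 0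
  have h1 : IsSemialgebraicFunOn ℚ (KZ.cube n) (fun _ : Fin n → ℝ => (1 : ℝ)) := by
    simpa using isSemialgebraicFunOn_ratCast KZ.isSemialgebraic_cube 1
  have hFb : IsSemialgebraicFunOn ℚ {z : Fin (n + 1) → ℝ | Fin.init z ∈ KZ.cube n ∧
      0 ≤ z (Fin.last n) ∧ z (Fin.last n) ≤ 1} F := by
    rw [← KZ.cube_succ_eq]; exact hFs
  have hder : ∀ x ∈ KZ.cube n, ∀ t ∈ Ioo ((fun _ : Fin n → ℝ => (0 : ℝ)) x)
      ((fun _ : Fin n → ℝ => (1 : ℝ)) x),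
      HasDerivAt (fun s : ℝ => F (Fin.snoc x s))
        ((fun w => fderiv ℝ F w (Pi.single (Fin.last n) 1)) (Fin.snoc x t)) t :=
    fun x hx t ht => stokesCal_hasDerivAt_snoc
      ((hFa _ (KZ.snoc_mem_cube_iff.2 ⟨hx, ht.1.le, ht.2.le⟩)).differentiableAt)
  have hopen := IsSemialgebraicFunOn.hasDerivAt_last_isSemialgebraic_holds n (KZ.cube n)
    (fun _ => 0) (fun _ => 1) F (fun w => fderiv ℝ F w (Pi.single (Fin.last n) 1)) h0 h1 hFb hder
  refine stokesCal_isSemialgebraicFunOn_of_subset_closure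
    (s := {z : Fin (n + 1) → ℝ | Fin.init z ∈ KZ.cube n ∧ 0 < z (Fin.last n) ∧ z (Fin.last n) < 1})
    hopen (fun z hz => ?_) (stokesCal_cube_subset_closure_band n) KZ.isCompact_cube
    (stokesCal_analyticOnNhd_fderiv_apply hFa _).continuousOn
  rw [KZ.cube_succ_eq]
  exact ⟨hz.1, hz.2.1.le, hz.2.2.le⟩

/-- **A Stokes element along the last coordinate of the cube is a KZ relation.** For `F` analytic
near `[0,1]ⁿ⁺¹` and `ℚ`-semialgebraic on it, the tame cube representation
`[[0,1]ⁿ⁺¹, ∂_last F − F(init ·, 1) + F(init ·, 0)]` lies in `KZ.relations`: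
`[[0,1]ⁿ⁺¹, ∂_last F] ∼ [[0,1]ⁿ, F(·,1) − F(·,0)]` (Newton–Leibniz along the last coordinate) and
`[[0,1]ⁿ⁺¹, g ∘ init] ∼ [[0,1]ⁿ, g]` (Newton–Leibniz with primitive `(x, t) ↦ t · g x`), glued by
integrand additivity. [Kontsevich–Zagier 2001, §1.2 rules (1), (3); Ayoub 2014, Def. 10] -/
theorem stokesCal_last (n : ℕ) (F : (Fin (n + 1) → ℝ) → ℝ)
    (hFa : AnalyticOnNhd ℝ F (KZ.cube (n + 1)))
    (hFs : IsSemialgebraicFunOn ℚ (KZ.cube (n + 1)) F) :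
    ∃ S : IntegralRep (n + 1), S.IsTameCube ∧
      (S.integrand = fun w => fderiv ℝ F w (Pi.single (Fin.last n) 1) -
        (F (Fin.snoc (Fin.init w) 1) - F (Fin.snoc (Fin.init w) 0))) ∧
      of S ∈ relations := by
  -- the partial derivative `A = ∂_last F`
  have hAa : AnalyticOnNhd ℝ (fun w => fderiv ℝ F w (Pi.single (Fin.last n) 1)) (KZ.cube (n + 1)) :=
    stokesCal_analyticOnNhd_fderiv_apply hFa _
  have hAs : IsSemialgebraicFunOn ℚ (KZ.cube (n + 1))
      (fun w => fderiv ℝ F w (Pi.single (Fin.last n) 1)) :=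
    stokesCal_isSemialgebraicFunOn_fderiv_last hFa hFs
  -- the boundary difference `g x = F (x, 1) - F (x, 0)`
  obtain ⟨g, hg⟩ : ∃ g : (Fin n → ℝ) → ℝ, g = fun x => F (Fin.snoc x 1) - F (Fin.snoc x 0) :=
    ⟨_, rfl⟩
  have hmaps : ∀ a : ℝ, 0 ≤ a → a ≤ 1 → MapsTo (fun x : Fin n → ℝ =>
      (Fin.snoc x a : Fin (n + 1) → ℝ)) (KZ.cube n) (KZ.cube (n + 1)) :=
    fun a h0 h1 x hx => KZ.snoc_mem_cube_iff.2 ⟨hx, h0, h1⟩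
  have hga : AnalyticOnNhd ℝ g (KZ.cube n) := by
    rw [hg]
    exact (hFa.comp ((stokesCal_analyticOnNhd_snoc n 1).mono (subset_univ _))
      (hmaps 1 zero_le_one le_rfl)).sub
      (hFa.comp ((stokesCal_analyticOnNhd_snoc n 0).mono (subset_univ _))
        (hmaps 0 le_rfl zero_le_one))
  have hgs : IsSemialgebraicFunOn ℚ (KZ.cube n) g := by
    rw [hg]
    exact IsSemialgebraicFunOn.sub_holds
      (IsSemialgebraicFunOn.comp_isSemialgebraicMapOn_holds hFs
        (by simpa using stokesCal_isSemialgebraicMapOn_snoc n 1) (hmaps 1 zero_le_one le_rfl))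
      (IsSemialgebraicFunOn.comp_isSemialgebraicMapOn_holds hFs
        (by simpa using stokesCal_isSemialgebraicMapOn_snoc n 0) (hmaps 0 le_rfl zero_le_one))
  -- the slab integrand `g ∘ init` and the slab primitive `t · g (init)`
  have hinit : MapsTo (fun w : Fin (n + 1) → ℝ => (Fin.init w : Fin n → ℝ)) (KZ.cube (n + 1))
      (KZ.cube n) := fun w hw j => hw (Fin.castSucc j)
  have hDa : AnalyticOnNhd ℝ (fun w : Fin (n + 1) → ℝ => g (Fin.init w)) (KZ.cube (n + 1)) :=
    hga.comp (AnalyticOnNhd.pi fun j => (ContinuousLinearMap.proj (R := ℝ)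
      (φ := fun _ : Fin (n + 1) => ℝ) (Fin.castSucc j)).analyticOnNhd _) hinit
  have hDs : IsSemialgebraicFunOn ℚ (KZ.cube (n + 1)) (fun w => g (Fin.init w)) :=
    hgs.comp_init_mono KZ.isSemialgebraic_cube fun w hw => hinit hw
  have hPa : AnalyticOnNhd ℝ (fun w : Fin (n + 1) → ℝ => w (Fin.last n) * g (Fin.init w))
      (KZ.cube (n + 1)) :=
    ((ContinuousLinearMap.proj (R := ℝ) (φ := fun _ : Fin (n + 1) => ℝ)
      (Fin.last n)).analyticOnNhd _).mul hDa
  have hPs : IsSemialgebraicFunOn ℚ (KZ.cube (n + 1))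
      (fun w => w (Fin.last n) * g (Fin.init w)) :=
    (IsSemialgebraicFunOn.mul_holds (isSemialgebraicFunOn_apply KZ.isSemialgebraic_cube
      (Fin.last n)) hDs).congr fun _ _ => rfl
  -- the four representations `[∂_last F]`, `[g]`, `[g ∘ init]`, `[∂_last F - g ∘ init]`
  obtain ⟨RA, hRAd, hRAi⟩ : ∃ R : IntegralRep (n + 1), R.domain = KZ.cube (n + 1) ∧
      R.integrand = fun w => fderiv ℝ F w (Pi.single (Fin.last n) 1) :=
    ⟨IntegralRep.tameCube _ hAa hAs, rfl, rfl⟩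
  obtain ⟨D', hD'd, hD'i⟩ : ∃ R : IntegralRep n, R.domain = KZ.cube n ∧ R.integrand = g :=
    ⟨IntegralRep.tameCube g hga hgs, rfl, rfl⟩
  obtain ⟨D, hDd, hDi⟩ : ∃ R : IntegralRep (n + 1), R.domain = KZ.cube (n + 1) ∧
      R.integrand = fun w => g (Fin.init w) :=
    ⟨IntegralRep.tameCube _ hDa hDs, rfl, rfl⟩
  have hSa : AnalyticOnNhd ℝ
      (fun w => fderiv ℝ F w (Pi.single (Fin.last n) 1) - g (Fin.init w)) (KZ.cube (n + 1)) :=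
    hAa.sub hDa
  obtain ⟨S, hSd, hSi⟩ : ∃ R : IntegralRep (n + 1), R.domain = KZ.cube (n + 1) ∧
      R.integrand = fun w => fderiv ℝ F w (Pi.single (Fin.last n) 1) - g (Fin.init w) :=
    ⟨IntegralRep.tameCube _ hSa ((IsSemialgebraicFunOn.sub_holds hAs hDs).congr fun _ _ => rfl),
      rfl, rfl⟩
  -- (i) linearity of the integrand: `[S] − [RA] − [−D]`; (ii) `[D] + [−D]`
  have h1 : of S - of RA - of D.neg ∈ relations := by
    refine integrandAddRel_subset_relations ⟨n + 1, S, RA, D.neg, ?_, ?_, ?_, rfl⟩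
    · rw [hRAd, hSd]
    · rw [IntegralRep.domain_neg, hDd, hSd]
    · intro w _
      simp only [hSi, hRAi, IntegralRep.integrand_neg, hDi, Pi.add_apply, Pi.neg_apply]
      ring
  have h2 : of D + of D.neg ∈ relations :=
    of_add_of_mem_relations_of_eqOn_neg (r := D) (r' := D.neg) rfl fun _ _ => rfl
  -- (iii) Newton–Leibniz along the last coordinate: `[RA] − [D']`
  have h3 : of RA - of D' ∈ relations := by
    refine KZ.cubicalStokesGens_subset_relations
      (KZ.mem_cubicalStokesGens (F := F) ⟨hRAd, by rw [hRAi]; exact hAa⟩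
        ⟨hD'd, by rw [hD'i]; exact hga⟩ hFa hFs ?_ ?_)
    · intro x hx t ht
      rw [hRAi]
      exact stokesCal_hasDerivAt_snoc
        ((hFa _ (KZ.snoc_mem_cube_iff.2 ⟨hx, ht.1, ht.2⟩)).differentiableAt)
    · intro x _
      rw [hD'i, hg]
  -- (iv) the slab: `[D] − [D']`, primitive `t · g (init)`
  have h4 : of D - of D' ∈ relations := by
    refine KZ.cubicalStokesGens_subset_relations
      (KZ.mem_cubicalStokesGens (F := fun w => w (Fin.last n) * g (Fin.init w))
        ⟨hDd, by rw [hDi]; exact hDa⟩ ⟨hD'd, by rw [hD'i]; exact hga⟩ hPa hPs ?_ ?_)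
    · intro x _ t _
      rw [hDi]
      simp only [Fin.snoc_last, Fin.init_snoc]
      simpa using (hasDerivAt_id t).mul_const (g x)
    · intro x _
      simp [hD'i]
  refine ⟨S, ⟨hSd, by rw [hSi]; exact hSa⟩, by rw [hSi, hg], ?_⟩
  have : of S =
      (of S - of RA - of D.neg) + (of RA - of D') + (of D + of D.neg) - (of D - of D') := by abel
  rw [this]
  exact relations.sub_mem (relations.add_mem (relations.add_mem h1 h3) h2) h4

/-- **A Stokes element along any coordinate `c` of the cube is a KZ relation.** The coordinate
transposition `Φ z = z ∘ (c last)` is a change of variables of `[0,1]ᴹ` onto itself with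
`|det Φ| = 1` (`KZ.cubicalCovGens_subset_relations`), carrying the Stokes element of `G` along `c`
to the Stokes element of `G ∘ Φ` along the last coordinate (`stokesCal_last`).
[Kontsevich–Zagier 2001, §1.2 rule (2); Ayoub 2014, Def. 10] -/
theorem stokesCal_single {M : ℕ} (c : Fin M) (G : (Fin M → ℝ) → ℝ)
    (hGa : AnalyticOnNhd ℝ G (KZ.cube M)) (hGs : IsSemialgebraicFunOn ℚ (KZ.cube M) G) :
    ∃ S : IntegralRep M, S.domain = KZ.cube M ∧
      (∀ z ∈ KZ.cube M, S.integrand z =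
        fderiv ℝ G z (Pi.single c 1) - G (Function.update z c 1) + G (Function.update z c 0)) ∧
      of S ∈ relations := by
  cases M with
  | zero => exact c.elim0
  | succ n =>
  -- the transposition `σ = (c last)` and the coordinate permutation `Φ z = z ∘ σ`
  obtain ⟨σ, hσ⟩ : ∃ σ : Equiv.Perm (Fin (n + 1)), σ = Equiv.swap c (Fin.last n) := ⟨_, rfl⟩
  have hσσ : ∀ i, σ (σ i) = i := fun i => by rw [hσ, Equiv.swap_apply_self]
  have hσeq : ∀ j, σ j = Fin.last n ↔ j = c := fun j => by
    rw [hσ, Equiv.swap_apply_eq_iff, Equiv.swap_apply_right]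
  let Φ : (Fin (n + 1) → ℝ) →L[ℝ] (Fin (n + 1) → ℝ) :=
    ContinuousLinearMap.pi fun i => ContinuousLinearMap.proj (σ i)
  have hΦ : ∀ z, Φ z = fun i => z (σ i) := fun z => rfl
  have hΦΦ : ∀ z, Φ (Φ z) = z := fun z => funext fun i => by simp only [hΦ, hσσ]
  have hΦcube : MapsTo Φ (KZ.cube (n + 1)) (KZ.cube (n + 1)) := fun z hz i => hz (σ i)
  have hset : {w : Fin (n + 1) → ℝ | (fun i => w (σ i)) ∈ KZ.cube (n + 1)} = KZ.cube (n + 1) :=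
    Set.ext fun w => ⟨fun hw i => by simpa [hσσ] using hw (σ i), fun hw => hΦcube hw⟩
  have hcompσ : ∀ f : (Fin (n + 1) → ℝ) → ℝ, IsSemialgebraicFunOn ℚ (KZ.cube (n + 1)) f →
      IsSemialgebraicFunOn ℚ (KZ.cube (n + 1)) (fun w => f (Φ w)) := fun f hf => by
    have h := hf.comp_equiv σ
    rwa [hset] at h
  have himg : Φ '' KZ.cube (n + 1) = KZ.cube (n + 1) :=
    Subset.antisymm (by rintro _ ⟨z, hz, rfl⟩; exact hΦcube hz) fun w hw => ⟨Φ w, hΦcube hw, hΦΦ w⟩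
  have hinj : InjOn Φ (KZ.cube (n + 1)) := fun z _ w _ h => by rw [← hΦΦ z, h, hΦΦ]
  have hΦs : IsSemialgebraicMapOn ℚ (KZ.cube (n + 1)) Φ := by
    refine (isSemialgebraicMapOn_aeval (R := ℝ) KZ.isSemialgebraic_cube
      (fun j => (MvPolynomial.X (σ j) : MvPolynomial (Fin (n + 1)) ℚ))).congr fun z _ => ?_
    funext j
    simp [hΦ]
  have hΦa : ∀ i, AnalyticOnNhd ℝ (fun z => Φ z i) (KZ.cube (n + 1)) := fun i =>
    (ContinuousLinearMap.proj (R := ℝ) (φ := fun _ : Fin (n + 1) => ℝ) (σ i)).analyticOnNhd _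
  have hdet : |Φ.det| = 1 := by
    have h2 : Φ.det * Φ.det = 1 := by
      have hcomp : (Φ : (Fin (n + 1) → ℝ) →ₗ[ℝ] (Fin (n + 1) → ℝ)).comp
          (Φ : (Fin (n + 1) → ℝ) →ₗ[ℝ] (Fin (n + 1) → ℝ)) = LinearMap.id :=
        LinearMap.ext fun z => by simp [hΦΦ]
      have h := congrArg LinearMap.det hcomp
      rwa [LinearMap.det_comp, LinearMap.det_id] at h
    rcases mul_self_eq_one_iff.mp h2 with h | h <;> simp [h]
  -- the Stokes element of `F = G ∘ Φ` along the last coordinate, transported back along `Φ`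
  have hFa : AnalyticOnNhd ℝ (fun w => G (Φ w)) (KZ.cube (n + 1)) :=
    hGa.comp (Φ.analyticOnNhd _) hΦcube
  obtain ⟨S', hS't, hS'i, hS'rel⟩ := stokesCal_last n (fun w => G (Φ w)) hFa (hcompσ G hGs)
  have hSa : AnalyticOnNhd ℝ (fun z => S'.integrand (Φ z)) (KZ.cube (n + 1)) :=
    hS't.2.comp (Φ.analyticOnNhd _) hΦcube
  obtain ⟨S, hSd, hSi⟩ : ∃ R : IntegralRep (n + 1), R.domain = KZ.cube (n + 1) ∧
      R.integrand = fun z => S'.integrand (Φ z) :=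
    ⟨IntegralRep.tameCube _ hSa (hcompσ _ hS't.isSemialgebraicFunOn), rfl, rfl⟩
  have hcov : of S - of S' ∈ relations := by
    refine KZ.cubicalCovGens_subset_relations
      (KZ.mem_cubicalCovGens (Φ := Φ) (Φ' := fun _ => Φ) ⟨hSd, by rw [hSi]; exact hSa⟩ hS't hΦs
        (fun z _ => Φ.hasFDerivWithinAt) hinj himg hΦa fun z _ => ?_)
    simp only [hSi, hdet, mul_one]
  -- the derivative and the restrictions, transported
  have hΦe : Φ (Pi.single (Fin.last n) 1) = Pi.single c 1 :=
    funext fun j => by simp only [hΦ, Pi.single_apply, hσeq]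
  have hfd : ∀ z ∈ KZ.cube (n + 1), fderiv ℝ (fun w => G (Φ w)) (Φ z) (Pi.single (Fin.last n) 1) =
      fderiv ℝ G z (Pi.single c 1) := by
    intro z hz
    have hG' : HasFDerivAt G (fderiv ℝ G z) (Φ (Φ z)) := by
      rw [hΦΦ]; exact (hGa z hz).differentiableAt.hasFDerivAt
    have hcomp : HasFDerivAt (fun w => G (Φ w)) ((fderiv ℝ G z).comp Φ) (Φ z) :=
      hG'.comp (Φ z) Φ.hasFDerivAt
    rw [hcomp.fderiv, ContinuousLinearMap.comp_apply, hΦe]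
  have hupd : ∀ (z : Fin (n + 1) → ℝ) (a : ℝ),
      Φ (Fin.snoc (Fin.init (Φ z)) a) = Function.update z c a := by
    intro z a
    have h1 : (Fin.snoc (Fin.init (Φ z)) a : Fin (n + 1) → ℝ) =
        Function.update (Φ z) (Fin.last n) a := by
      conv_rhs => rw [← Fin.snoc_init_self (Φ z)]
      rw [Fin.update_snoc_last]
    rw [h1]
    funext j
    simp only [hΦ, Function.update_apply, hσeq, hσσ]
  refine ⟨S, hSd, fun z hz => ?_, ?_⟩
  · simp only [hSi, hS'i]
    rw [hfd z hz, hupd z 1, hupd z 0]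
    ring
  · have : of S = (of S - of S') + of S' := by abel
    rw [this]
    exact relations.add_mem hcov hS'rel

/-- **S5 (Stokes span calibration).** A cube representation whose integrand is a finite sum of real
Stokes elements `∂_{i j} Hⱼ − Hⱼ|_{x_{i j}=1} + Hⱼ|_{x_{i j}=0}` (tame `Hⱼ`) is a KZ relation: each
Stokes element is a relation (`stokesCal_single`: a transposition, Newton–Leibniz along the last
coordinate, a slab), and the sum is split off by iterated integrand additivity
(`KZ.of_sub_of_sub_sum_mem_relations`) with a zero representation.
[Ayoub 2014, Def. 10; Kontsevich–Zagier 2001, §1.2 rules (1)–(3)] -/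
theorem stub_stokesSpanCalibration :
    ∀ (M : ℕ) (t : IntegralRep M), t.domain = KZ.cube M → ∀ (k : ℕ) (i : Fin k → Fin M) (H : Fin k → (Fin M → ℝ) → ℝ), (∀ j, AnalyticOnNhd ℝ (H j) (KZ.cube M) ∧ IsSemialgebraicFunOn ℚ (KZ.cube M) (H j)) → (∀ z ∈ KZ.cube M, t.integrand z = ∑ j, (fderiv ℝ (H j) z (Pi.single (i j) 1) - H j (Function.update z (i j) 1) + H j (Function.update z (i j) 0))) → of t ∈ relations := by
  intro M t htd k i H hH ht
  choose S hSd hSi hSrel using fun j => stokesCal_single (i j) (H j) (hH j).1 (hH j).2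
  obtain ⟨R₀, hR₀d, hR₀i⟩ := exists_zeroRep (σ := KZ.cube M) KZ.isSemialgebraic_cube
  have h1 : of t - of R₀ - ∑ j, of (S j) ∈ relations := by
    refine of_sub_of_sub_sum_mem_relations k t R₀ S (by rw [hR₀d, htd]) (fun j => by rw [hSd, htd])
      fun z hz => ?_
    rw [htd] at hz
    simp only [hR₀i, Pi.zero_apply, zero_add]
    rw [ht z hz]
    exact Finset.sum_congr rfl fun j _ => (hSi j z hz).symm
  have h2 : of R₀ ∈ relations := of_mem_relations_of_eqOn_zero R₀ fun x _ => by rw [hR₀i]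
  have h3 : ∑ j, of (S j) ∈ relations := sum_mem fun j _ => hSrel j
  have : of t = (of t - of R₀ - ∑ j, of (S j)) + of R₀ + ∑ j, of (S j) := by abel
  rw [this]
  exact relations.add_mem (relations.add_mem h1 h2) h3

end Summit.KontsevichZagierPeriods.FurushoPentagon.SectorToKernel
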